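import Literature.MathematicalPhysics.QuantumFieldTheory.Balaban1983to89.B8Ineq159PeriodizedTowerSourcePoint
import Literature.MathematicalPhysics.QuantumFieldTheory.Balaban1983to89.B8SockB9P3H2AtPeriodizedTower

/-!
# `Balaban1983to89.B8SockB9P3SrcAtPeriodizedTower` — [Balaban1985RegularSpaces] (1.146) p. 101, (1.57)–(1.59) p. 86, (1.131) p. 99, p. 77 («Ω_j = T_η»): THE SOURCED
# b9-SOCKET OF PROPOSITION 3's FRAME — the body of the slot's binder `SB9srcHP` ([4] Thm 3.3 WITH SOURCE, Theorem 8's input) — HOLDS AT THE PERIODISED SECT.-F TOWER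
# `Ωᴾ = periodize (fun _ ↦ P) (cubeFam true L a M ρ k)` WITH THE PRINTED CLASS `towerBondsP` OVER PRINT'S LEVEL SETS, PER SHAPE (constants independent of `P`, `a`, `η`)

statement-level skeleton of published theorems with citation tags; proofs where landed; nothing here is a claim about the
Yang–Mills mass gap

`[Balaban1985RegularSpaces]` ("B8", CMP **99** (1985) 75–102) (1.36)–(1.38) p. 82, (1.55)–(1.59) p. 86, (1.7) p. 77, (1.31) p. 82, (1.131) p. 99, (1.140) p. 100, (1.146)
p. 101 («R(U₀)D^{η*}_{U₀}A = f, R(U₀)f = f», «|f|₍₋₂₎, |∇^η_{U₀}f|₍₋₃₎ < γ₈(α₀+α₁)»), p. 77 («Ω_j = T_η»); [4] = `[Balaban1985BackgroundPropagators]` Thm 3.3 p. 399 (with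
source), (3.40)–(3.47) pp. 397–398; [B6] = `[Balaban1984PropagatorsII]` (2.1)–(2.3) p. 224; [B7] = `[Balaban1985Averaging]` Prop. 5 p. 42.

CITATION HEADER (lean-in-tree rule).  Cell `pub-ymgap` (YM Track A, HUMAN RULING D-0062 ∕ D-0149), DAG node N05 = [B8], width seat `pub-ymgap-dag-n05-w3` (g5),
CLAIM-2 file (D3) — the periodic twin of this lineage's g4 `B8SockB9P3SrcAtTopCubeTower` (p632228).  WHY.  On the (β′-PERIODIC) road of record (director-ym №217) the
Sect.-F tower is read on the torus; file (B) `B8SockB9P3H2AtPeriodizedTower` inhabits the SOURCELESS socket there; THIS FILE inhabits the SOURCED one, from the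
translate-wise sourced pointwise bound of file (D2) `B8Ineq159PeriodizedTowerSourcePoint`.

THE MATHEMATICS (kernel-checked).  ★★ `srcLines_periodize` (core: the slot's `SB9srcHP` binders at `Ω := Ωᴾ`, `Λb := towerBondsP L Ωᴾ (Λs ·)`, `Λs k = Lam L Ωᴾ k` up
to the depth ⊢ the five lines, the Hölder line over ANY pair class `memH ⊆ AdmPair`); ★★★ `exists_sockB9P3src_periodize` (the slot's two-point pair class, by `exact`).
PROOF: `Ωᴾ₀ = T` ⇒ `η²|f| ≤ s := γ₈(α₀+α₁)` and `(1/iη) log W = A′`; (D2) gives `η|A′| ≤ P₀N + P₁s` everywhere and `Lʲη|A′| ≤ P₀N + P₁s` on the sides touching any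
translate's `□_j`; a bond side-touching `Ωᴾ_j`, `j ≥ 1`, side-touches some translate's `□_j` ((A1) §4); lines 2∕4 crude from the pointwise bound, line 3 is `J =
D^{η*}D^η A′`, line 5 from line 2's pointwise form (g4's `weight_mul_hquot_le`); the average family is bounded by [B7] Prop. 5 in the regime `cP3·L² ≤ α_Q` ((A2) §1
box lemma).  Constants: `B₀ = 4(d+1)L^{3k}P₀`, `γ″ = P₁γ₈∕P₀`, `B₀β = 4L^{2k}(Lᵏ)^β P₀`, `γβ = 4L^{2k}(Lᵏ)^β P₁γ₈`.

HONEST SCOPE ∕ A6 — READ THIS.  (a) Per-SHAPE constants (through (U)'s non-explicit `α₀(□), B″(□)` and the width `W(□)`), NOT on `P`, `a`, `η`: the positive A6 datum for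
the `SB9srcHP`-shape body at a NESTED `P`-periodic (1.5)-member; NOT [4] Thm 3.3 with source (uniform constants = N06); no letter of [4] assumed or proved; the hypotheses
`f ∈ R(U₀)`, `|∇f|₍₋₃₎`, `U₀ ∈ 𝔄_k` for `W·U₀`, self-adjointness, «`f = 0` ∕ `A′ = 0` off `Ω₀ = T`» are idle (located remark, not a defect).  (b) No index ∕ pin ∕ door ∕
model of the periodic road typed.  (c) Non-vacuity: `U₀ = W = 1`, `f = 0`, `A′ = 0`.  Count-neutral; N05 NOT discharged; no count claim; one finite `𝕋⁴` programme at fixed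
`ε`, Bałaban as printed; the YM mass gap (Clay) is NOT proved by any of this — R4 closes the conditional finite-`𝕋⁴` rung `BalabanLadder.UV` only; nothing continuum ∕ ℝ⁴ ∕
OS.  No `sorry`, no `def`, no `instance`, no `notation`.  Unit `pub-ymgap-dag-n05-w3` (g5), 2026-08-28.
-/

noncomputable section

namespace Literature.MathematicalPhysics.QuantumFieldTheory.Balaban1983to89.B8SockB9P3SrcAtPeriodizedTower

open B7Prop1Explicit B7Prop2Explicit B7Prop1Local B7Eq78Linearization
open B7Prop4GeneralLevels (linCovIter)
open B7Prop5GeneralLevels (thetaGen)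
open B8Ineq132 (covDerivFwd BondTouches InAk)
open B8Eq140Level (SideTouches sideTouches_of_bondTouches)
open B8Eq146AExpansion (iEta plaqCovDeriv norm_I_eta_smul norm_iEta_le)
open B8Eq143PlaqExpansion (pdiv)
open B8Eq155JBound (Jcur wsup le_wsup wsup_nonneg)
open B8ScaledSupNorm (bondNorm msup weight Bdd msup_le msup_nonneg weight_mul_norm_le_msup weight_neg_natCast)
open B8Eq138LandauZd (IsLandau146 IsLandau146W InR138 QT covLap covDivB logCfg)
open B8Eq184Proof (cfgExp)
open B8Lemma1NonAbelian (mulCfg)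
open B9Eq340HolderZd (hquot AdmPair)
open B8Eq131CubesAdmissible (cubeFam cubeFam_true_zero cubeFam_of_pos)
open B8Eq131Cubes (cube gs)
open B8CubeMemberZd (cubeLamS)
open B8TowerBondsPrinted (towerBondsP)
open B9SupplySockB9P3ZdSocketBoundaryMode (logCfg_cfgExp_of_small exists_ne_fin)
open B8Ineq159TopCubeTowerReads (bdd_Jcur_of_bound towerBondsP_congr_levels)
open B9Eq316AveragingTransposeZd (Reg17 alphaQ reg17_of_inAk norm_linCovIter_le_of_reg17)
open B8Ineq159TopCubeTowerSourceReads (reg17_shift)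
open B8Ineq159PeriodizedTowerSourcePoint (exists_pointBound_src_periodize)
open B8SockB9P3H2AtTopCubeTower (weight_mul_hquot_le)
open B8Prop7GlevZd3 (inAk_mono_alpha)
open B15LatticeCubeTorus (periodize)
open B8Ineq159PeriodizedTowerReads B8Ineq159PeriodizedTowerClass

-- `Site` alone would resolve to the torus sites of `Setup.lean`; re-export the `ℤ^d` sites of `B7Prop1Explicit`.
export B7Prop1Explicit (Site)

variable {d : ℕ} {𝔹 : Type*} [CStarAlgebra 𝔹] [Nontrivial 𝔹]

/-- ★★ **THE CORE: the five sourced lines at the periodised Sect.-F tower, the Hölder line over ANY pair class inside the admissible pairs** (`memH j ⊆ AdmPair η len`).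
Binders = the slot's `SB9srcHP` text at `Ω := Ωᴾ`, `Λb := towerBondsP L Ωᴾ (Λs ·)`, with `Λs k = Lam L Ωᴾ k` up to the depth; constants before `∀ a η P`.
[cite: Balaban1985RegularSpaces, (1.146) p.101, (1.57)–(1.59) p.86, (1.38) p.82, (1.31) p.82, (1.131) p.99, (1.7) p.77, p.77 («Ω_j = T_η»); Balaban1985BackgroundPropagators, Thm 3.3 p.399, (3.40)–(3.47) pp.397–398; Balaban1984PropagatorsII, (2.1)–(2.3) p.224; Balaban1985Averaging, Prop. 5 p.42] -/
theorem srcLines_periodize [FiniteDimensional ℂ 𝔹] (hd2 : 2 ≤ d) {L : ℕ} (hL2 : 2 ≤ L) (M : ℕ) {ρ : ℕ} (hρ : L ≤ ρ)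
    {k : ℕ} (hk : 1 ≤ k) {β : ℝ} (hβ : 0 ≤ β) {len : Site d → ℝ} (hlen : ∀ z : Site d, z ≠ 0 → 1 ≤ len z) {γ₈ : ℝ} (hγ₈ : 0 < γ₈) :
    ∃ B₀ B₀β cP3 γ'' γβ : ℝ, 0 < B₀ ∧ 0 < B₀β ∧ 0 < cP3 ∧ 0 < γ'' ∧ 0 < γβ ∧ ∀ (a : Site d) (η : ℝ), 0 < η →
      ∀ (P : ℕ) (q : ℤ), (L : ℤ) ^ k * q = P → L ^ k * M + 2 * (ρ * gs L k) ≤ P →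
      ∀ (Ω : ℕ → Set (Site d)) (Λs : ℕ → ℕ → Set (Site d)), Ω = periodize (fun _ : Fin d => P) (cubeFam true L a M ρ k) →
      (∀ j, j ≤ k → Λs k j = B11Eq7Convention.Lam L Ω k j) →
      ∀ memH : ℕ → (Fin d × Fin d × (Site d × Site d)) → Prop, (∀ j p, memH j p → p.2.2 ∈ AdmPair η len) →
      ∀ α₀ α₁ α₂ : ℝ, 0 < α₀ → α₀ ≤ cP3 → 0 < α₁ → 0 < α₂ → α₂ ≤ cP3 →
        ∀ (U₀ W : Site d → Fin d → 𝔹ˣ), (∀ x κ, U₀ x κ ∈ unitaryUnits 𝔹) → (∀ x κ, W x κ ∈ unitaryUnits 𝔹) →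
        ∀ f : Site d → 𝔹, InR138 L k η (Ω 0) (Λs k) U₀ f →
        (∀ x, IsSelfAdjoint (f x)) → (∀ x, x ∉ Ω 0 → f x = 0) →
        Bdd L k η (-(2 : ℝ)) (fun j (x : Site d) => x ∈ Ω j) f →
        msup L k η (-(2 : ℝ)) (fun j (x : Site d) => x ∈ Ω j) f < γ₈ * (α₀ + α₁) →
        msup L k η (-(3 : ℝ)) (fun j (p : Fin d × Site d) => p.2 ∈ Ω j) (fun p => covDerivFwd η U₀ p.1 f p.2) < γ₈ * (α₀ + α₁) →
        InAk L k η α₀ Ω U₀ → InAk L k η α₀ Ω (mulCfg W U₀) →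
        IsLandau146W L k η (Ω 0) (Λs k) U₀ f W →
        ∀ A' : Site d → Fin d → 𝔹, (∀ y τ, IsSelfAdjoint (A' y τ)) →
        (∀ j, j ≤ k → ∀ (y : Site d) (τ : Fin d), SideTouches (Ω j) y τ →
          W y τ = cfgExp η A' y τ ∧ ‖A' y τ‖ ≤ α₂ * ((L : ℝ) ^ j * η)⁻¹) →
        (∀ (y : Site d) (τ : Fin d), (∀ j, j ≤ k → ¬ SideTouches (Ω j) y τ) → A' y τ = 0) →
        msup L k η (-(1 : ℝ)) (fun j (b : Site d × Fin d) => SideTouches (Ω j) b.1 b.2) (fun b => A' b.1 b.2)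
            ≤ B₀ * (bondNorm L k η (-(3 : ℝ)) Ω (fun x μ => Jcur η U₀ A' μ x)
              + wsup 1 (fun p : {p : ℕ × (Site d × Fin d) // p.1 ≤ k ∧ p.2 ∈ towerBondsP L Ω (Λs k) p.1} =>
                  linCovIter L U₀ (iEta η A') p.1.1 p.1.2.1 p.1.2.2)) + γ'' * B₀ * (α₀ + α₁) ∧
          msup L k η (-(2 : ℝ)) (fun j (t : Fin d × Fin d × Site d) => SideTouches (Ω j) t.2.2 t.2.1)
              (fun t => covDerivFwd η U₀ t.1 (fun z => A' z t.2.1) t.2.2)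
            ≤ B₀ * (bondNorm L k η (-(3 : ℝ)) Ω (fun x μ => Jcur η U₀ A' μ x)
              + wsup 1 (fun p : {p : ℕ × (Site d × Fin d) // p.1 ≤ k ∧ p.2 ∈ towerBondsP L Ω (Λs k) p.1} =>
                  linCovIter L U₀ (iEta η A') p.1.1 p.1.2.1 p.1.2.2)) + γ'' * B₀ * (α₀ + α₁) ∧
          bondNorm L k η (-(3 : ℝ)) Ω (fun x μ => pdiv η U₀ (plaqCovDeriv η U₀ A') μ x)
            ≤ B₀ * (bondNorm L k η (-(3 : ℝ)) Ω (fun x μ => Jcur η U₀ A' μ x)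
              + wsup 1 (fun p : {p : ℕ × (Site d × Fin d) // p.1 ≤ k ∧ p.2 ∈ towerBondsP L Ω (Λs k) p.1} =>
                  linCovIter L U₀ (iEta η A') p.1.1 p.1.2.1 p.1.2.2)) + γ'' * B₀ * (α₀ + α₁) ∧
          bondNorm L k η (-(3 : ℝ)) Ω (fun x μ => covLap η U₀ (fun z => A' z μ) x)
            ≤ B₀ * (bondNorm L k η (-(3 : ℝ)) Ω (fun x μ => Jcur η U₀ A' μ x)
              + wsup 1 (fun p : {p : ℕ × (Site d × Fin d) // p.1 ≤ k ∧ p.2 ∈ towerBondsP L Ω (Λs k) p.1} =>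
                  linCovIter L U₀ (iEta η A') p.1.1 p.1.2.1 p.1.2.2)) + γ'' * B₀ * (α₀ + α₁) ∧
          msup L k η (-(2 + β)) memH (fun p => hquot η β len U₀ (covDerivFwd η U₀ p.1 (fun z => A' z p.2.1)) p.2.2)
            ≤ B₀β * (bondNorm L k η (-(3 : ℝ)) Ω (fun x μ => Jcur η U₀ A' μ x)
              + wsup 1 (fun p : {p : ℕ × (Site d × Fin d) // p.1 ≤ k ∧ p.2 ∈ towerBondsP L Ω (Λs k) p.1} =>
                  linCovIter L U₀ (iEta η A') p.1.1 p.1.2.1 p.1.2.2)) + γβ * (α₀ + α₁) := by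
  classical
  obtain ⟨cP3, P₀, P₁, hcP3pos, hcP3h, hcP3Q, h1P, hP₁0, HP⟩ := exists_pointBound_src_periodize (𝔹 := 𝔹) hd2 hL2 M hρ hk
  have hP₀0 : 0 < P₀ := by linarith
  have hL1 : 1 ≤ L := le_trans (by norm_num) hL2
  have hL1r : (1 : ℝ) ≤ L := by exact_mod_cast hL1
  have hLk1 : (1 : ℝ) ≤ (L : ℝ) ^ k := one_le_pow₀ hL1r
  have hd1 : (1 : ℝ) ≤ d := by exact_mod_cast (le_trans (by norm_num) hd2 : 1 ≤ d)
  -- the constants: `B₀ = K·P₀`, `γ″B₀ = K·P₁γ₈`, `K = 4(d+1)L^{3k}`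
  obtain ⟨K, hK⟩ : ∃ c : ℝ, c = 4 * ((d : ℝ) + 1) * ((L : ℝ) ^ k) ^ 3 := ⟨_, rfl⟩
  have hK0 : 0 < K := by rw [hK]; positivity
  have hK1 : 1 ≤ K := by rw [hK]; exact one_le_mul_of_one_le_of_one_le (by linarith) (one_le_pow₀ hLk1)
  have hK2 : 2 * ((L : ℝ) ^ k) ^ 2 ≤ K := by
    rw [hK]
    exact (mul_le_mul_of_nonneg_left (pow_le_pow_right₀ hLk1 (by norm_num : 2 ≤ 3)) (by norm_num)).trans
      (mul_le_mul_of_nonneg_right (by linarith) (by positivity))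
  have hK4 : 4 * (d : ℝ) * ((L : ℝ) ^ k) ^ 3 ≤ K := by rw [hK]; exact mul_le_mul_of_nonneg_right (by linarith) (by positivity)
  refine ⟨K * P₀, 4 * ((L : ℝ) ^ k) ^ 2 * ((L : ℝ) ^ k) ^ β * P₀, cP3, P₁ * γ₈ / P₀, 4 * ((L : ℝ) ^ k) ^ 2 * ((L : ℝ) ^ k) ^ β * P₁ * γ₈,
    by positivity, by positivity, hcP3pos, by positivity, by positivity, ?_⟩
  intro a η hη P q hq hP Ω Λs hΩ hΛs memH hmemH α₀ α₁ α₂ hα₀ hα₀c hα₁ hα₂ hα₂c U₀ W hU₀ _ f _ _ _ hfB hfsup _ hAk _ hLanW A' _ h41 _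
  subst hΩ
  set Ω : ℕ → Set (Site d) := periodize (fun _ : Fin d => P) (cubeFam true L a M ρ k) with hΩdef
  have hU1 : ∀ x κ, U₀ x κ ∈ U1 𝔹 := fun x κ => unitaryUnits_le_U1 (hU₀ x κ)
  have hηne : η ≠ 0 := hη.ne'
  have hΩ0 : Ω 0 = Set.univ := periodize_cubeFam_true_zero P L a M ρ k
  obtain ⟨s, hs⟩ : ∃ t : ℝ, t = γ₈ * (α₀ + α₁) := ⟨_, rfl⟩
  have hs0 : 0 < s := by rw [hs]; positivity
  -- (0) `Ω₀ = T`: the (1.41) clause at level `0` is global; `W = e^{iηA′}`, `(1/iη) log W = A′`; the source is bounded by `s η⁻²`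
  have hST0 : ∀ (y : Site d) (τ : Fin d), SideTouches (Ω 0) y τ := fun y τ => by
    obtain ⟨κ, hκ⟩ := exists_ne_fin hd2 τ
    rw [hΩ0]
    exact sideTouches_of_bondTouches hκ (Or.inl (Set.mem_univ y))
  have hAb : ∀ (y : Site d) (τ : Fin d), ‖A' y τ‖ ≤ α₂ * η⁻¹ := fun y τ => by
    have h := (h41 0 (Nat.zero_le k) y τ (hST0 y τ)).2
    rwa [pow_zero, one_mul] at h
  have hα₂η : 0 ≤ α₂ * η⁻¹ := by positivity
  have hWexp : W = cfgExp η A' := funext fun y => funext fun τ => (h41 0 (Nat.zero_le k) y τ (hST0 y τ)).1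
  have hlog : logCfg η W = A' := by
    rw [hWexp]
    refine logCfg_cfgExp_of_small hη fun y τ => ?_
    have h1 : η * ‖A' y τ‖ ≤ α₂ := by
      calc η * ‖A' y τ‖ ≤ η * (α₂ * η⁻¹) := mul_le_mul_of_nonneg_left (hAb y τ) hη.le
        _ = α₂ := by field_simp
    linarith [Real.log_two_gt_d9, hα₂c.trans hcP3h]
  have hfpt : ∀ x : Site d, ‖f x‖ ≤ s * (η ^ 2)⁻¹ := fun x => by
    have h := weight_mul_norm_le_msup hfB (Nat.zero_le k) (i := x) (by rw [hΩ0]; exact Set.mem_univ x)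
    have e2 : weight L η (-(2 : ℝ)) 0 = η ^ 2 := by
      rw [show (-(2 : ℝ)) = -((2 : ℕ) : ℝ) by norm_num, weight_neg_natCast, pow_zero, one_mul]
    rw [e2] at h
    rw [le_mul_inv_iff₀ (by positivity : (0 : ℝ) < η ^ 2), mul_comm, hs]
    exact h.trans hfsup.le
  have hLan' : ∃ μ : ℕ → Site d → 𝔹, ∀ x, covLap η U₀ (fun z => covDivB η U₀ A' z - f z) x = QT L k (Λs k) U₀ μ x := by
    have h := hLanW
    unfold IsLandau146W IsLandau146 at h
    rw [hlog, hΩ0] at h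
    obtain ⟨-, μ, hμ⟩ := h
    exact ⟨μ, fun x => by have h1 := hμ x (Set.mem_univ x); rwa [Set.indicator_univ] at h1⟩
  -- (1) the target `N = |J(A′)|₍₋₃₎ + |B₁(A′)|` dominates the current and the class averages (bounded families; [B7] Prop. 5 in the regime for the averages)
  obtain ⟨N, hN⟩ : ∃ t : ℝ, t = bondNorm L k η (-(3 : ℝ)) Ω (fun x μ => Jcur η U₀ A' μ x) +
    wsup 1 (fun p : {p : ℕ × (Site d × Fin d) // p.1 ≤ k ∧ p.2 ∈ towerBondsP L Ω (Λs k) p.1} =>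
      linCovIter L U₀ (iEta η A') p.1.1 p.1.2.1 p.1.2.2) := ⟨_, rfl⟩
  have hN0 : 0 ≤ N := by rw [hN]; exact add_nonneg (msup_nonneg L k hη.le _ _ _) (wsup_nonneg zero_le_one _)
  have hBJ := bdd_Jcur_of_bound hL1 hη hU1 k Ω hα₂η hAb
  have hiEta : ∀ (y : Site d) (τ : Fin d), ‖iEta η A' y τ‖ ≤ η * (α₂ * η⁻¹) := fun y τ => norm_iEta_le hη.le hAb y τ
  have hTB : ∀ j, j ≤ k → towerBondsP L Ω (Λs k) j = towerBondsP L Ω (B11Eq7Convention.Lam L Ω k) j := fun j hj =>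
    towerBondsP_congr_levels L Ω j (hΛs j hj) (hΛs (j - 1) (by omega))
  have hAkP : InAk L k η cP3 Ω U₀ := inAk_mono_alpha hη hα₀c hAk
  have hreg : Reg17 L k (fun j => Ω (j - 1)) (cP3 * (L : ℝ) ^ 2) U₀ := reg17_shift hL1 hcP3pos.le (reg17_of_inAk hAkP le_rfl)
  have hCavg : ∀ p : {p : ℕ × (Site d × Fin d) // p.1 ≤ k ∧ p.2 ∈ towerBondsP L Ω (Λs k) p.1},
      1 * ‖linCovIter L U₀ (iEta η A') p.1.1 p.1.2.1 p.1.2.2‖ ≤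
        2 * d * ((1 + thetaGen d L (cP3 * (L : ℝ) ^ 2)) * (L : ℝ) ^ k) * (η * (α₂ * η⁻¹)) := by
    rintro ⟨⟨j, c⟩, hj, hc⟩
    rw [one_mul]
    have hc' : c ∈ towerBondsP L Ω (B11Eq7Convention.Lam L Ω k) j := by rw [← hTB j hj]; exact hc
    have hbox := box_subset_periodize_pred_of_mem_towerBondsP a M ρ k hq hc'
    refine (norm_linCovIter_le_of_reg17 hL2 (by positivity) hcP3Q hU₀ hreg hj c.1 c.2 hbox (iEta η A') (by positivity)
      (fun y μ _ => hiEta y μ)).trans ?_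
    have hθ : 0 ≤ thetaGen d L (cP3 * (L : ℝ) ^ 2) := by unfold thetaGen; positivity
    have hLj : (L : ℝ) ^ j ≤ (L : ℝ) ^ k := pow_le_pow_right₀ hL1r hj
    gcongr
  have hNJ : ∀ j, j ≤ k → ∀ (x : Site d) (μ : Fin d), BondTouches (Ω j) x μ →
      ((L : ℝ) ^ j * η) ^ 3 * ‖Jcur η U₀ A' μ x‖ ≤ N := by
    intro j hj x μ hb
    have h := weight_mul_norm_le_msup hBJ hj (i := (x, μ)) hb
    rw [show (-(3 : ℝ)) = -((3 : ℕ) : ℝ) by norm_num, weight_neg_natCast] at h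
    rw [hN]; exact h.trans (le_add_of_nonneg_right (wsup_nonneg zero_le_one _))
  have hNavg : ∀ j, j ≤ k → ∀ c ∈ towerBondsP L Ω (Λs k) j, ‖linCovIter L U₀ (iEta η A') j c.1 c.2‖ ≤ N := by
    intro j hj c hc
    have h := le_wsup hCavg ⟨(j, c), hj, hc⟩
    rw [one_mul] at h
    rw [hN]; exact h.trans (le_add_of_nonneg_left (msup_nonneg L k hη.le _ _ _))
  -- (2) the pointwise bounds of `B8Ineq159PeriodizedTowerSourcePoint`
  obtain ⟨POINT, LEV⟩ := HP a η hη P q hq hP Ω (Λs k) rfl hΛs U₀ hU₀ hAkP A' f s hs0.le hfpt hLan' N hN0 hNJ hNavg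
  obtain ⟨Q, hQ⟩ : ∃ t : ℝ, t = P₀ * N + P₁ * s := ⟨_, rfl⟩
  rw [← hQ] at POINT LEV
  have hQ0 : 0 ≤ Q := by rw [hQ]; positivity
  have POINT' : ∀ (y : Site d) (τ : Fin d), ‖A' y τ‖ ≤ Q * η⁻¹ := fun y τ => by
    rw [le_mul_inv_iff₀ hη, mul_comm]; exact POINT y τ
  -- the right-hand sides: `c·Q ≤ K·P₀·N + K·P₁·s = B₀·N + γ″B₀(α₀+α₁)` for `c ≤ K`
  have hGid : K * P₀ * N + K * P₁ * s = K * P₀ * N + P₁ * γ₈ / P₀ * (K * P₀) * (α₀ + α₁) := by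
    rw [hs]; field_simp
  have hfin : ∀ c : ℝ, 0 ≤ c → c ≤ K → c * Q ≤ K * P₀ * N + P₁ * γ₈ / P₀ * (K * P₀) * (α₀ + α₁) := by
    intro c _ hcK
    rw [← hGid, hQ, mul_add, ← mul_assoc, ← mul_assoc]
    exact add_le_add (mul_le_mul_of_nonneg_right (mul_le_mul_of_nonneg_right hcK hP₀0.le) hN0)
      (mul_le_mul_of_nonneg_right (mul_le_mul_of_nonneg_right hcK hP₁0.le) hs0.le)
  have hLj : ∀ j, j ≤ k → (L : ℝ) ^ j ≤ (L : ℝ) ^ k := fun j hj => pow_le_pow_right₀ hL1r hj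
  rw [← hN]
  refine ⟨?_, ?_, ?_, ?_, ?_⟩
  · -- LINE 1
    refine (msup_le hQ0 fun j hj b hb => ?_).trans ((one_mul Q).symm.trans_le (hfin 1 zero_le_one hK1))
    rw [show (-(1 : ℝ)) = -((1 : ℕ) : ℝ) by norm_num, weight_neg_natCast, pow_one]
    rcases Nat.eq_zero_or_pos j with rfl | hj1
    · rw [pow_zero, one_mul]; exact POINT b.1 b.2
    · obtain ⟨v, hv⟩ := exists_translate_of_sideTouches_periodize a M ρ hq hj1 hj hb
      exact LEV j hj1 hj v b.1 b.2 hv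
  · -- LINE 2
    refine (msup_le (by positivity) fun j hj t _ => ?_).trans (hfin _ (by positivity) hK2)
    rw [show (-(2 : ℝ)) = -((2 : ℕ) : ℝ) by norm_num, weight_neg_natCast]
    have hD := B8Ineq159StencilsNearFlat.norm_covDerivFwd_le hU1 hη t.1 (fun z => A' z t.2.1) t.2.2
    calc ((L : ℝ) ^ j * η) ^ 2 * ‖covDerivFwd η U₀ t.1 (fun z => A' z t.2.1) t.2.2‖
        ≤ ((L : ℝ) ^ k * η) ^ 2 * (η⁻¹ * (‖A' (t.2.2 + e t.1) t.2.1‖ + ‖A' t.2.2 t.2.1‖)) :=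
          mul_le_mul (pow_le_pow_left₀ (by positivity) (mul_le_mul_of_nonneg_right (hLj j hj) hη.le) 2) hD (norm_nonneg _) (by positivity)
      _ = ((L : ℝ) ^ k) ^ 2 * (η * ‖A' (t.2.2 + e t.1) t.2.1‖ + η * ‖A' t.2.2 t.2.1‖) := by field_simp
      _ ≤ ((L : ℝ) ^ k) ^ 2 * (Q + Q) := mul_le_mul_of_nonneg_left (add_le_add (POINT _ _) (POINT _ _)) (by positivity)
      _ = 2 * ((L : ℝ) ^ k) ^ 2 * Q := by ring
  · -- LINE 3 (`J := pdiv ∘ plaqCovDeriv` by definition)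
    calc bondNorm L k η (-(3 : ℝ)) Ω (fun x μ => pdiv η U₀ (plaqCovDeriv η U₀ A') μ x)
        = bondNorm L k η (-(3 : ℝ)) Ω (fun x μ => Jcur η U₀ A' μ x) := rfl
      _ ≤ N := by rw [hN]; exact le_add_of_nonneg_right (wsup_nonneg zero_le_one _)
      _ ≤ 1 * Q := by
          rw [one_mul, hQ]
          exact (le_mul_of_one_le_left hN0 h1P).trans (le_add_of_nonneg_right (by positivity))
      _ ≤ _ := hfin 1 zero_le_one hK1
  · -- LINE 4
    refine (msup_le (by positivity) fun j hj b _ => ?_).trans (hfin _ (by positivity) hK4)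
    rw [show (-(3 : ℝ)) = -((3 : ℕ) : ℝ) by norm_num, weight_neg_natCast]
    have hC := B8Ineq159StencilsNearFlat.norm_covLap_le hU1 hη (g := fun z => A' z b.2) (fun z => POINT' z b.2) b.1
    calc ((L : ℝ) ^ j * η) ^ 3 * ‖covLap η U₀ (fun z => A' z b.2) b.1‖
        ≤ ((L : ℝ) ^ k * η) ^ 3 * (4 * d * (η ^ 2)⁻¹ * (Q * η⁻¹)) :=
          mul_le_mul (pow_le_pow_left₀ (by positivity) (mul_le_mul_of_nonneg_right (hLj j hj) hη.le) 3) hC (norm_nonneg _) (by positivity)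
      _ = 4 * d * ((L : ℝ) ^ k) ^ 3 * Q := by field_simp
  · -- LINE 5 (the Hölder quotient of `∇A′` from `η²|∇A′| ≤ 2Q`)
    refine (msup_le (c := 4 * ((L : ℝ) ^ k) ^ 2 * ((L : ℝ) ^ k) ^ β * Q) (by positivity) fun j hj p hp => ?_).trans
      (le_of_eq (by rw [hQ, hs]; ring))
    have hD : ∀ z, η ^ 2 * ‖covDerivFwd η U₀ p.1 (fun w => A' w p.2.1) z‖ ≤ 2 * Q := by
      intro z
      have h := B8Ineq159StencilsNearFlat.norm_covDerivFwd_le hU1 hη p.1 (fun w => A' w p.2.1) z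
      calc η ^ 2 * ‖covDerivFwd η U₀ p.1 (fun w => A' w p.2.1) z‖ ≤ η ^ 2 * (η⁻¹ * (‖A' (z + e p.1) p.2.1‖ + ‖A' z p.2.1‖)) :=
            mul_le_mul_of_nonneg_left h (by positivity)
        _ = η * ‖A' (z + e p.1) p.2.1‖ + η * ‖A' z p.2.1‖ := by field_simp
        _ ≤ Q + Q := add_le_add (POINT _ _) (POINT _ _)
        _ = 2 * Q := by ring
    calc weight L η (-(2 + β)) j * ‖hquot η β len U₀ (covDerivFwd η U₀ p.1 fun w => A' w p.2.1) p.2.2‖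
        ≤ 2 * ((L : ℝ) ^ k) ^ 2 * ((L : ℝ) ^ k) ^ β * (2 * Q) :=
          weight_mul_hquot_le hL1 hη hβ hlen hU1 (by positivity) hD hj (x := p.2.2.1) (x' := p.2.2.2) (hmemH j p hp)
      _ = 4 * ((L : ℝ) ^ k) ^ 2 * ((L : ℝ) ^ k) ^ β * Q := by ring

/-- ★★★ **THE SOURCED b9-SOCKET OF PROPOSITION 3's FRAME HOLDS AT THE PERIODISED SECT.-F TOWER WITH THE PRINTED CLASS OVER PRINT'S LEVEL SETS, PER SHAPE**: for every
`γ₈ > 0`, `∃ B₀ B₀β cP3 γ″ γβ > 0` (shape-dependent) before `∀ a η P Λs` (`Lᵏ ∣ P`, `Lᵏ·M + 2·ρ·gs L k ≤ P`, `Λs k = Lam L Ωᴾ k` up to the depth): the TEXT of the slot's binder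
`SB9srcHP` at `Ω := Ωᴾ`, `Λb := towerBondsP …` — the five lines of (1.59) with source slack `γ″B₀(α₀+α₁)` (`γβ(α₀+α₁)`).  NOT [4] Thm 3.3's uniform constants.
[cite: Balaban1985RegularSpaces, (1.146) p.101, (1.57)–(1.59) p.86, (1.38) p.82, (1.31) p.82, (1.131) p.99, (1.7) p.77, p.77 («Ω_j = T_η»); Balaban1985BackgroundPropagators, Thm 3.3 p.399, (3.43), (3.47) p.398; Balaban1984PropagatorsII, (2.1)–(2.3) p.224] -/
theorem exists_sockB9P3src_periodize [FiniteDimensional ℂ 𝔹] (hd2 : 2 ≤ d) {L : ℕ} (hL2 : 2 ≤ L) (M : ℕ) {ρ : ℕ} (hρ : L ≤ ρ)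
    {k : ℕ} (hk : 1 ≤ k) {β : ℝ} (hβ : 0 ≤ β) {len : Site d → ℝ} (hlen : ∀ z : Site d, z ≠ 0 → 1 ≤ len z) {γ₈ : ℝ} (hγ₈ : 0 < γ₈) :
    ∃ B₀ B₀β cP3 γ'' γβ : ℝ, 0 < B₀ ∧ 0 < B₀β ∧ 0 < cP3 ∧ 0 < γ'' ∧ 0 < γβ ∧ ∀ (a : Site d) (η : ℝ), 0 < η →
      ∀ P : ℕ, L ^ k ∣ P → L ^ k * M + 2 * (ρ * gs L k) ≤ P →
      ∀ Λs : ℕ → ℕ → Set (Site d),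
        (∀ j, j ≤ k → Λs k j = B11Eq7Convention.Lam L (periodize (fun _ : Fin d => P) (cubeFam true L a M ρ k)) k j) →
      ∀ α₀ α₁ α₂ : ℝ, 0 < α₀ → α₀ ≤ cP3 → 0 < α₁ → 0 < α₂ → α₂ ≤ cP3 →
        ∀ (U₀ W : Site d → Fin d → 𝔹ˣ), (∀ x κ, U₀ x κ ∈ unitaryUnits 𝔹) → (∀ x κ, W x κ ∈ unitaryUnits 𝔹) →
        ∀ f : Site d → 𝔹, InR138 L k η (periodize (fun _ : Fin d => P) (cubeFam true L a M ρ k) 0) (Λs k) U₀ f →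
        (∀ x, IsSelfAdjoint (f x)) → (∀ x, x ∉ periodize (fun _ : Fin d => P) (cubeFam true L a M ρ k) 0 → f x = 0) →
        Bdd L k η (-(2 : ℝ)) (fun j (x : Site d) => x ∈ periodize (fun _ : Fin d => P) (cubeFam true L a M ρ k) j) f →
        msup L k η (-(2 : ℝ)) (fun j (x : Site d) => x ∈ periodize (fun _ : Fin d => P) (cubeFam true L a M ρ k) j) f < γ₈ * (α₀ + α₁) →
        msup L k η (-(3 : ℝ)) (fun j (p : Fin d × Site d) => p.2 ∈ periodize (fun _ : Fin d => P) (cubeFam true L a M ρ k) j)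
          (fun p => covDerivFwd η U₀ p.1 f p.2) < γ₈ * (α₀ + α₁) →
        InAk L k η α₀ (periodize (fun _ : Fin d => P) (cubeFam true L a M ρ k)) U₀ →
        InAk L k η α₀ (periodize (fun _ : Fin d => P) (cubeFam true L a M ρ k)) (mulCfg W U₀) →
        IsLandau146W L k η (periodize (fun _ : Fin d => P) (cubeFam true L a M ρ k) 0) (Λs k) U₀ f W →
        ∀ A' : Site d → Fin d → 𝔹, (∀ y τ, IsSelfAdjoint (A' y τ)) →
        (∀ j, j ≤ k → ∀ (y : Site d) (τ : Fin d), SideTouches (periodize (fun _ : Fin d => P) (cubeFam true L a M ρ k) j) y τ →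
          W y τ = cfgExp η A' y τ ∧ ‖A' y τ‖ ≤ α₂ * ((L : ℝ) ^ j * η)⁻¹) →
        (∀ (y : Site d) (τ : Fin d), (∀ j, j ≤ k → ¬ SideTouches (periodize (fun _ : Fin d => P) (cubeFam true L a M ρ k) j) y τ) → A' y τ = 0) →
        msup L k η (-(1 : ℝ)) (fun j (b : Site d × Fin d) => SideTouches (periodize (fun _ : Fin d => P) (cubeFam true L a M ρ k) j) b.1 b.2)
              (fun b => A' b.1 b.2)
            ≤ B₀ * (bondNorm L k η (-(3 : ℝ)) (periodize (fun _ : Fin d => P) (cubeFam true L a M ρ k)) (fun x μ => Jcur η U₀ A' μ x)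
              + wsup 1 (fun p : {p : ℕ × (Site d × Fin d) // p.1 ≤ k ∧
                  p.2 ∈ towerBondsP L (periodize (fun _ : Fin d => P) (cubeFam true L a M ρ k)) (Λs k) p.1} =>
                  linCovIter L U₀ (iEta η A') p.1.1 p.1.2.1 p.1.2.2)) + γ'' * B₀ * (α₀ + α₁) ∧
          msup L k η (-(2 : ℝ)) (fun j (t : Fin d × Fin d × Site d) => SideTouches (periodize (fun _ : Fin d => P) (cubeFam true L a M ρ k) j) t.2.2 t.2.1)
              (fun t => covDerivFwd η U₀ t.1 (fun z => A' z t.2.1) t.2.2)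
            ≤ B₀ * (bondNorm L k η (-(3 : ℝ)) (periodize (fun _ : Fin d => P) (cubeFam true L a M ρ k)) (fun x μ => Jcur η U₀ A' μ x)
              + wsup 1 (fun p : {p : ℕ × (Site d × Fin d) // p.1 ≤ k ∧
                  p.2 ∈ towerBondsP L (periodize (fun _ : Fin d => P) (cubeFam true L a M ρ k)) (Λs k) p.1} =>
                  linCovIter L U₀ (iEta η A') p.1.1 p.1.2.1 p.1.2.2)) + γ'' * B₀ * (α₀ + α₁) ∧
          bondNorm L k η (-(3 : ℝ)) (periodize (fun _ : Fin d => P) (cubeFam true L a M ρ k)) (fun x μ => pdiv η U₀ (plaqCovDeriv η U₀ A') μ x)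
            ≤ B₀ * (bondNorm L k η (-(3 : ℝ)) (periodize (fun _ : Fin d => P) (cubeFam true L a M ρ k)) (fun x μ => Jcur η U₀ A' μ x)
              + wsup 1 (fun p : {p : ℕ × (Site d × Fin d) // p.1 ≤ k ∧
                  p.2 ∈ towerBondsP L (periodize (fun _ : Fin d => P) (cubeFam true L a M ρ k)) (Λs k) p.1} =>
                  linCovIter L U₀ (iEta η A') p.1.1 p.1.2.1 p.1.2.2)) + γ'' * B₀ * (α₀ + α₁) ∧
          bondNorm L k η (-(3 : ℝ)) (periodize (fun _ : Fin d => P) (cubeFam true L a M ρ k)) (fun x μ => covLap η U₀ (fun z => A' z μ) x)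
            ≤ B₀ * (bondNorm L k η (-(3 : ℝ)) (periodize (fun _ : Fin d => P) (cubeFam true L a M ρ k)) (fun x μ => Jcur η U₀ A' μ x)
              + wsup 1 (fun p : {p : ℕ × (Site d × Fin d) // p.1 ≤ k ∧
                  p.2 ∈ towerBondsP L (periodize (fun _ : Fin d => P) (cubeFam true L a M ρ k)) (Λs k) p.1} =>
                  linCovIter L U₀ (iEta η A') p.1.1 p.1.2.1 p.1.2.2)) + γ'' * B₀ * (α₀ + α₁) ∧
          msup L k η (-(2 + β)) (fun j (p : Fin d × Fin d × (Site d × Site d)) =>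
                p.2.2 ∈ AdmPair η len ∧ p.2.2.1 ∈ periodize (fun _ : Fin d => P) (cubeFam true L a M ρ k) j ∧
                  p.2.2.2 ∈ periodize (fun _ : Fin d => P) (cubeFam true L a M ρ k) j)
              (fun p => hquot η β len U₀ (covDerivFwd η U₀ p.1 (fun z => A' z p.2.1)) p.2.2)
            ≤ B₀β * (bondNorm L k η (-(3 : ℝ)) (periodize (fun _ : Fin d => P) (cubeFam true L a M ρ k)) (fun x μ => Jcur η U₀ A' μ x)
              + wsup 1 (fun p : {p : ℕ × (Site d × Fin d) // p.1 ≤ k ∧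
                  p.2 ∈ towerBondsP L (periodize (fun _ : Fin d => P) (cubeFam true L a M ρ k)) (Λs k) p.1} =>
                  linCovIter L U₀ (iEta η A') p.1.1 p.1.2.1 p.1.2.2)) + γβ * (α₀ + α₁) := by
  obtain ⟨B₀, B₀β, cP3, γ'', γβ, h1, h2, h3, h4, h5, H⟩ := srcLines_periodize (𝔹 := 𝔹) hd2 hL2 M hρ hk hβ hlen hγ₈
  refine ⟨B₀, B₀β, cP3, γ'', γβ, h1, h2, h3, h4, h5, fun a η hη P hdvd hP Λs hΛs => ?_⟩
  obtain ⟨q, hq⟩ := hdvd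
  exact H a η hη P q (by rw [hq]; push_cast; ring) hP _ Λs rfl hΛs
    (fun j p => p.2.2 ∈ AdmPair η len ∧ p.2.2.1 ∈ periodize (fun _ : Fin d => P) (cubeFam true L a M ρ k) j ∧
      p.2.2.2 ∈ periodize (fun _ : Fin d => P) (cubeFam true L a M ρ k) j) fun _ _ h => h.1

end Literature.MathematicalPhysics.QuantumFieldTheory.Balaban1983to89.B8SockB9P3SrcAtPeriodizedTower

end
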